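import Summits.Parity.BatemanHorn.Theorems.SoloInformedTrapezoidForm

/-!
# The trapezoid reduction: `TrapezoidCancellation → ErdosDivisorSumAsymptotic`

Informed soloist `solo-Parity-informed` (session 143), conjunct `BatemanHorn`, the `d ≥ 3` rung BELOW the parity
wall. Sequel to `SoloInformedTrapezoidForm` (the exact averaged form
`∑_{X₀<x'≤X₁} (Mid^w_g(x') − H^w_g(x'; E)) = Low + ∑_{X₁<e≤E} e⁻¹∑_{0<h<e} K_e(h) S_g(h; e)`, `|Low| ≤ D∑_{e≤X₁}ρ_g(e)`).

* `exists_abs_polyDivisorSum_sub_two_mul_smooth_le` — `S_g(x) = d·A_g·x log x + 2(Mid^w_g(x) − H^w_g(x;E)) + O(x)`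
  (hyperbola pairing + located heuristic + the two smoothing errors);
* `tendsto_div_mul_log_of_monotone` — THE SANDWICH: a monotone `S` whose short sums of `S(x') − c·x' log x'` over
  `x' ∈ (X₀, X₀+D]` are `o(D·X₀ log X₀)` uniformly in `δX₀ ≤ D ≤ X₀`, for every fixed `δ`, satisfies
  `S(x) ~ c·x log x` (monotonicity converts window averages of relative length `δ` into pointwise asymptotics up to
  `1 ± O(δ)`);
* **`erdosDivisorSumAsymptotic_of_trapezoidCancellation`** — for `g` irreducible of degree `≥ 3` and `Δ > 0`,
  `TrapezoidCancellation g Δ → ErdosDivisorSumAsymptotic g`, where `TrapezoidCancellation g Δ` asks, for every fixed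
  `δ ∈ (0,1)` and uniformly in `δX₀ ≤ D ≤ X₀`, that `∑_{X₁<e≤E*} e⁻¹ ∑_{0<h<e} K_e(h) S_g(h; e) = o(D·X₀ log X₀)` with
  the UNSHIFTED Hooley sums `S_g(h; e)` (`X₁ = X₀ + D`, `E* = max(X₁, max_{n≤X₁}|g(n)|)`).

Compared with `SoloInformedHooleyShiftHypothesis.erdosDivisorSumAsymptotic_of_target` the shifts `b` are gone; the
price is the trapezoid weight `W(m)` in the kernel, whose total variation in `m` is `D = W(1)` (no jump) — this is
what the second-order Abel summation of the sequel exploits. Nothing here moves a wall row; verdict NO PATH unchanged.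
-/

namespace Summit.Parity.BatemanHorn.Theorems

open Finset Polynomial Filter Topology
open Literature.NumberTheory.Sieve (polyRootCountMod exists_sum_rootCount_le)

/-! ### `S_g` against the smooth located form -/

/-- **`S_g(x) = d·A_g·x log x + 2(Mid^w_g(x) − H^w_g(x; E)) + O(x)`** for `g` irreducible of degree `d ≥ 3`,
`Δ > 0`, `x ≥ 2` and any admissible `E` — the combination of the hyperbola pairing
(`exists_abs_polyDivisorSum_sub_located_sub_log_le_of_two_le`), the located heuristic
(`exists_abs_polyLocatedHeuristic_sub_le`) and the two smoothing errors of `SoloInformedSmoothHyperbolaReduction`.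
[this work] -/
theorem exists_abs_polyDivisorSum_sub_two_mul_smooth_le {g : ℤ[X]} (hirr : Irreducible g)
    (hdeg : 3 ≤ g.natDegree) {Δ : ℝ} (hΔ : 0 < Δ) :
    ∃ C : ℝ, ∀ x E : ℕ, 2 ≤ x → (∀ n ∈ Icc 1 x, (g.eval (n : ℤ)).natAbs ≤ E) →
      |(polyDivisorSum g x : ℝ) - 2 * (polySmoothMid g Δ x - polySmoothHeur g Δ x E)
          - (g.natDegree : ℝ) * rootLevelConst g * ((x : ℝ) * Real.log x)| ≤ C * x := by
  obtain ⟨C₁, hC₁⟩ := exists_abs_polyDivisorSum_sub_located_sub_log_le_of_two_le hirr (by omega)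
  obtain ⟨C₂, hC₂⟩ := exists_abs_polySmoothMid_sub_located_le hirr hdeg hΔ
  obtain ⟨C₃, hC₃⟩ := exists_abs_polySmoothHeur_sub_le hirr (by omega) hΔ
  obtain ⟨C₄, hC₄⟩ := exists_abs_polyLocatedHeuristic_sub_le hirr (by omega)
  refine ⟨C₁ + 2 * C₂ + 2 * C₃ + 2 * C₄, fun x E hx hE => ?_⟩
  have h1 := abs_le.mp (hC₁ x hx)
  have h2 := abs_le.mp (hC₂ x hx)
  have h3 := abs_le.mp (hC₃ x E hE)
  have h4 := abs_le.mp (hC₄ x (by omega))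
  have hsplit : (polyDivisorSum g x : ℝ) - 2 * (polySmoothMid g Δ x - polySmoothHeur g Δ x E)
        - (g.natDegree : ℝ) * rootLevelConst g * ((x : ℝ) * Real.log x)
      = ((polyDivisorSum g x : ℝ) - 2 * (polyLocatedRootCount g x : ℝ)
            - 2 * rootLevelConst g * (x : ℝ) * Real.log x)
        - 2 * (polySmoothMid g Δ x - polyLocatedRootCount g x)
        + 2 * (polySmoothHeur g Δ x E - polyLocatedHeuristic g x)
        + 2 * (polyLocatedHeuristic g x
            - ((g.natDegree : ℝ) - 2) / 2 * rootLevelConst g * ((x : ℝ) * Real.log x)) := by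
    ring
  rw [hsplit, abs_le]
  constructor <;> linarith

/-- `S_g` is monotone (real form). [folklore] -/
theorem polyDivisorSum_cast_mono (g : ℤ[X]) : Monotone fun x : ℕ => (polyDivisorSum g x : ℝ) := by
  intro x y hxy
  have h : polyDivisorSum g x ≤ polyDivisorSum g y := by
    unfold polyDivisorSum
    exact sum_le_sum_of_subset (Icc_subset_Icc_right hxy)
  show (polyDivisorSum g x : ℝ) ≤ polyDivisorSum g y
  exact_mod_cast h

/-! ### The sandwich: short averages of a monotone sequence -/

/-- `x ↦ x log x` is monotone on `ℕ`. [folklore] -/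
theorem natCast_mul_log_mono {x y : ℕ} (h : x ≤ y) : (x : ℝ) * Real.log x ≤ (y : ℝ) * Real.log y := by
  rcases Nat.eq_zero_or_pos x with rfl | hx
  · rw [Nat.cast_zero, zero_mul]
    exact mul_nonneg (Nat.cast_nonneg _) (Real.log_natCast_nonneg _)
  · exact mul_le_mul (by exact_mod_cast h) (Real.log_le_log (by exact_mod_cast hx) (by exact_mod_cast h))
      (Real.log_natCast_nonneg _) (Nat.cast_nonneg _)

/-- `1 ≤ log x` for `x ≥ 3`. [folklore] -/
private theorem one_le_log_of_three_le {x : ℕ} (hx : 3 ≤ x) : 1 ≤ Real.log x := by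
  rw [Real.le_log_iff_exp_le (by positivity)]
  calc Real.exp 1 ≤ 2.7182818286 := Real.exp_one_lt_d9.le
    _ ≤ 3 := by norm_num
    _ ≤ x := by exact_mod_cast hx

/-- **Regular variation of `x log x`**: `y ≤ (1+t)x`, `0 ≤ t ≤ 1`, `x ≥ 3` give `y log y ≤ (1 + 3t)·x log x`.
[folklore] -/
theorem natCast_mul_log_le_of_le_mul {t : ℝ} (ht0 : 0 ≤ t) (ht1 : t ≤ 1) {x y : ℕ} (hx : 3 ≤ x)
    (hy : (y : ℝ) ≤ (1 + t) * x) : (y : ℝ) * Real.log y ≤ (1 + 3 * t) * ((x : ℝ) * Real.log x) := by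
  have hx0 : (0 : ℝ) < x := by exact_mod_cast (show 0 < x by omega)
  have hlog1 := one_le_log_of_three_le hx
  have hF0 : 0 ≤ (x : ℝ) * Real.log x := by positivity
  rcases Nat.eq_zero_or_pos y with rfl | hy0
  · rw [Nat.cast_zero, zero_mul]
    positivity
  have hy0' : (0 : ℝ) < y := by exact_mod_cast hy0
  have hlogy : Real.log y ≤ t + Real.log x := by
    calc Real.log y ≤ Real.log ((1 + t) * x) := Real.log_le_log hy0' hy
      _ = Real.log (1 + t) + Real.log x := Real.log_mul (by positivity) hx0.ne'
      _ ≤ t + Real.log x := by linarith [Real.log_le_sub_one_of_pos (by positivity : (0 : ℝ) < 1 + t)]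
  have hxF : (x : ℝ) ≤ x * Real.log x := le_mul_of_one_le_right hx0.le hlog1
  calc (y : ℝ) * Real.log y ≤ ((1 + t) * x) * (t + Real.log x) :=
        mul_le_mul hy hlogy (Real.log_natCast_nonneg _) (by positivity)
    _ = (1 + t) * ((x : ℝ) * Real.log x) + t * (1 + t) * x := by ring
    _ ≤ (1 + t) * ((x : ℝ) * Real.log x) + t * (1 + t) * (x * Real.log x) :=
        add_le_add le_rfl (mul_le_mul_of_nonneg_left hxF (by positivity))
    _ = (1 + t) ^ 2 * ((x : ℝ) * Real.log x) := by ring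
    _ ≤ (1 + 3 * t) * ((x : ℝ) * Real.log x) := by
        refine mul_le_mul_of_nonneg_right ?_ hF0
        nlinarith [mul_le_of_le_one_left ht0 ht1]

/-- **The sandwich.**  Let `S : ℕ → ℝ` be monotone and `c ≥ 0`.  Suppose that for every fixed `δ ∈ (0,1)` the
short sums of `S(x') − c·x' log x'` over `x' ∈ (X₀, X₀ + D]`, uniformly in `δX₀ ≤ D ≤ X₀`, are `o(D·X₀ log X₀)`.
Then `S(x)/(x log x) → c`. (Monotonicity converts averaged asymptotics over windows of relative length `δ` into
pointwise ones up to a factor `1 ± O(δ)`.) [folklore] -/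
theorem tendsto_div_mul_log_of_monotone {S : ℕ → ℝ} (hS : Monotone S) {c : ℝ} (hc : 0 ≤ c)
    (H : ∀ δ : ℝ, 0 < δ → δ < 1 → ∀ ε : ℝ, 0 < ε → ∃ x₀ : ℕ, ∀ X₀ D : ℕ, x₀ ≤ X₀ →
      δ * X₀ ≤ D → D ≤ X₀ →
        |∑ x' ∈ Ioc X₀ (X₀ + D), (S x' - c * ((x' : ℝ) * Real.log x'))| ≤ ε * D * ((X₀ : ℝ) * Real.log X₀)) :
    Tendsto (fun x : ℕ => S x / ((x : ℝ) * Real.log x)) atTop (𝓝 c) := by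
  rw [Metric.tendsto_atTop]
  intro ε' hε'
  -- the window parameter `δ`
  set δ : ℝ := min (1 / 8) (ε' / (64 * (c + 1))) with hδdef
  have hδ0 : 0 < δ := lt_min (by norm_num) (by positivity)
  have hδ8 : δ ≤ 1 / 8 := min_le_left _ _
  have hcδ : c * δ ≤ ε' / 64 := by
    calc c * δ ≤ (c + 1) * (ε' / (64 * (c + 1))) :=
          mul_le_mul (by linarith) (min_le_right _ _) hδ0.le (by positivity)
      _ = ε' / 64 := by field_simp
  obtain ⟨x₀, hx₀⟩ := H δ hδ0 (by linarith) (ε' / 4) (by positivity)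
  refine ⟨max (2 * x₀) (⌈2 / δ⌉₊ + 6), fun x hx => ?_⟩
  have hx1 : 2 * x₀ ≤ x := le_of_max_le_left hx
  have hx2 : ⌈2 / δ⌉₊ + 6 ≤ x := le_of_max_le_right hx
  have hx6 : 6 ≤ x := by omega
  have hxR : (0 : ℝ) < x := by exact_mod_cast (show 0 < x by omega)
  have hδx : 2 ≤ δ * x := by
    have h1 : 2 / δ ≤ x := (Nat.le_ceil _).trans (by exact_mod_cast (show ⌈2 / δ⌉₊ ≤ x by omega))
    rwa [div_le_iff₀ hδ0, mul_comm] at h1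
  -- the window length `D`
  set D : ℕ := ⌊δ * x⌋₊ + 1 with hDdef
  have hDR : (D : ℝ) = ⌊δ * x⌋₊ + 1 := by rw [hDdef]; push_cast; ring
  have hD1 : δ * x ≤ D := by rw [hDR]; exact (Nat.lt_floor_add_one _).le
  have hD2 : (D : ℝ) ≤ δ * x + 1 := by rw [hDR]; linarith [Nat.floor_le (by positivity : 0 ≤ δ * x)]
  have hD3 : (D : ℝ) ≤ 2 * δ * x := by linarith
  have h2D : 2 * D ≤ x := by
    have h1 : δ * x ≤ 1 / 8 * x := mul_le_mul_of_nonneg_right hδ8 hxR.le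
    have h : 2 * (D : ℝ) ≤ x := by linarith
    exact_mod_cast h
  have hDx : D ≤ x := by omega
  have hD0 : (0 : ℝ) < D := by rw [hDR]; positivity
  have hFx : 0 < (x : ℝ) * Real.log x :=
    mul_pos hxR (Real.log_pos (by exact_mod_cast (show 1 < x by omega)))
  have hF0 : ∀ n : ℕ, 0 ≤ (n : ℝ) * Real.log n := fun n => mul_nonneg (Nat.cast_nonneg _) (Real.log_natCast_nonneg _)
  -- UPPER WINDOW `(x, x + D]`
  have hU := (abs_le.mp (hx₀ x D (by omega) hD1 hDx)).2
  have hsumS : (D : ℝ) * S x ≤ ∑ x' ∈ Ioc x (x + D), S x' := by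
    have h := card_nsmul_le_sum (Ioc x (x + D)) S (S x) fun x' hx' => hS (mem_Ioc.mp hx').1.le
    rwa [Nat.card_Ioc, Nat.add_sub_cancel_left, nsmul_eq_mul] at h
  have hsumF : ∑ x' ∈ Ioc x (x + D), c * ((x' : ℝ) * Real.log x')
      ≤ D * (c * (((x + D : ℕ) : ℝ) * Real.log ((x + D : ℕ) : ℝ))) := by
    have h := sum_le_card_nsmul (Ioc x (x + D)) (fun x' : ℕ => c * ((x' : ℝ) * Real.log x'))
      (c * (((x + D : ℕ) : ℝ) * Real.log ((x + D : ℕ) : ℝ)))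
      fun x' hx' => mul_le_mul_of_nonneg_left (natCast_mul_log_mono (mem_Ioc.mp hx').2) hc
    rwa [Nat.card_Ioc, Nat.add_sub_cancel_left, nsmul_eq_mul] at h
  have hsplitU : ∑ x' ∈ Ioc x (x + D), S x'
      = ∑ x' ∈ Ioc x (x + D), (S x' - c * ((x' : ℝ) * Real.log x'))
        + ∑ x' ∈ Ioc x (x + D), c * ((x' : ℝ) * Real.log x') := by
    rw [← sum_add_distrib]
    exact sum_congr rfl fun _ _ => by ring
  have hup : S x ≤ c * (((x + D : ℕ) : ℝ) * Real.log ((x + D : ℕ) : ℝ)) + ε' / 4 * ((x : ℝ) * Real.log x) := by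
    have h3 : (D : ℝ) * S x
        ≤ D * (c * (((x + D : ℕ) : ℝ) * Real.log ((x + D : ℕ) : ℝ)) + ε' / 4 * ((x : ℝ) * Real.log x)) := by
      linarith
    exact le_of_mul_le_mul_left h3 hD0
  have hFup : ((x + D : ℕ) : ℝ) * Real.log ((x + D : ℕ) : ℝ) ≤ (1 + 3 * (2 * δ)) * ((x : ℝ) * Real.log x) :=
    natCast_mul_log_le_of_le_mul (by positivity) (by linarith) (by omega) (by push_cast; linarith)
  -- LOWER WINDOW `(x − D, x]`
  have hxD : x - D + D = x := Nat.sub_add_cancel hDx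
  have hxDR : ((x - D : ℕ) : ℝ) = x - D := by push_cast [Nat.cast_sub hDx]; ring
  have hL' := hx₀ (x - D) D (by omega) (by rw [hxDR, mul_sub]; linarith [mul_nonneg hδ0.le hD0.le])
    (by omega)
  rw [hxD] at hL'
  have hL := (abs_le.mp hL').1
  have hsumS' : ∑ x' ∈ Ioc (x - D) x, S x' ≤ D * S x := by
    have h := sum_le_card_nsmul (Ioc (x - D) x) S (S x) fun x' hx' => hS (mem_Ioc.mp hx').2
    rwa [Nat.card_Ioc, Nat.sub_sub_self hDx, nsmul_eq_mul] at h
  have hsumF' : (D : ℝ) * (c * (((x - D : ℕ) : ℝ) * Real.log ((x - D : ℕ) : ℝ)))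
      ≤ ∑ x' ∈ Ioc (x - D) x, c * ((x' : ℝ) * Real.log x') := by
    have h := card_nsmul_le_sum (Ioc (x - D) x) (fun x' : ℕ => c * ((x' : ℝ) * Real.log x'))
      (c * (((x - D : ℕ) : ℝ) * Real.log ((x - D : ℕ) : ℝ)))
      fun x' hx' => mul_le_mul_of_nonneg_left (natCast_mul_log_mono (mem_Ioc.mp hx').1.le) hc
    rwa [Nat.card_Ioc, Nat.sub_sub_self hDx, nsmul_eq_mul] at h
  have hsplitL : ∑ x' ∈ Ioc (x - D) x, S x'
      = ∑ x' ∈ Ioc (x - D) x, (S x' - c * ((x' : ℝ) * Real.log x'))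
        + ∑ x' ∈ Ioc (x - D) x, c * ((x' : ℝ) * Real.log x') := by
    rw [← sum_add_distrib]
    exact sum_congr rfl fun _ _ => by ring
  have hFxD : ((x - D : ℕ) : ℝ) * Real.log ((x - D : ℕ) : ℝ) ≤ (x : ℝ) * Real.log x :=
    natCast_mul_log_mono (Nat.sub_le x D)
  have hlo : c * (((x - D : ℕ) : ℝ) * Real.log ((x - D : ℕ) : ℝ)) - ε' / 4 * ((x : ℝ) * Real.log x) ≤ S x := by
    have hε4 : ε' / 4 * D * (((x - D : ℕ) : ℝ) * Real.log ((x - D : ℕ) : ℝ))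
        ≤ ε' / 4 * D * ((x : ℝ) * Real.log x) := mul_le_mul_of_nonneg_left hFxD (by positivity)
    have h3 : (D : ℝ) * (c * (((x - D : ℕ) : ℝ) * Real.log ((x - D : ℕ) : ℝ))
        - ε' / 4 * ((x : ℝ) * Real.log x)) ≤ D * S x := by
      linarith
    exact le_of_mul_le_mul_left h3 hD0
  have hFlo : (x : ℝ) * Real.log x ≤ (1 + 3 * (4 * δ)) * (((x - D : ℕ) : ℝ) * Real.log ((x - D : ℕ) : ℝ)) := by
    refine natCast_mul_log_le_of_le_mul (by positivity) (by linarith) (by omega) ?_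
    rw [hxDR]
    have r2 : δ * (D : ℝ) ≤ δ * (2 * δ * x) := mul_le_mul_of_nonneg_left hD3 hδ0.le
    have r3 : δ * (δ * x) ≤ 1 / 8 * (δ * x) := mul_le_mul_of_nonneg_right hδ8 (by positivity)
    linarith
  -- CONCLUSION
  -- bookkeeping with `F = x log x`, `G = (x−D) log(x−D)`, `F' = (x+D) log(x+D)`
  have p1 : c * ((x : ℝ) * Real.log x) ≤ c * (((x - D : ℕ) : ℝ) * Real.log ((x - D : ℕ) : ℝ))
      + 12 * ((c * δ) * (((x - D : ℕ) : ℝ) * Real.log ((x - D : ℕ) : ℝ))) := by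
    calc c * ((x : ℝ) * Real.log x) ≤ c * ((1 + 3 * (4 * δ)) * (((x - D : ℕ) : ℝ) * Real.log ((x - D : ℕ) : ℝ))) :=
          mul_le_mul_of_nonneg_left hFlo hc
      _ = _ := by ring
  have p2 : (c * δ) * (((x - D : ℕ) : ℝ) * Real.log ((x - D : ℕ) : ℝ)) ≤ (c * δ) * ((x : ℝ) * Real.log x) :=
    mul_le_mul_of_nonneg_left hFxD (mul_nonneg hc hδ0.le)
  have p3 : (c * δ) * ((x : ℝ) * Real.log x) ≤ ε' / 64 * ((x : ℝ) * Real.log x) :=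
    mul_le_mul_of_nonneg_right hcδ hFx.le
  have q1 : c * (((x + D : ℕ) : ℝ) * Real.log ((x + D : ℕ) : ℝ))
      ≤ c * ((x : ℝ) * Real.log x) + 6 * ((c * δ) * ((x : ℝ) * Real.log x)) := by
    calc c * (((x + D : ℕ) : ℝ) * Real.log ((x + D : ℕ) : ℝ)) ≤ c * ((1 + 3 * (2 * δ)) * ((x : ℝ) * Real.log x)) :=
          mul_le_mul_of_nonneg_left hFup hc
      _ = _ := by ring
  have hεF : 0 < ε' * ((x : ℝ) * Real.log x) := mul_pos hε' hFx
  rw [Real.dist_eq, abs_lt]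
  constructor
  · -- lower: `S x > (c − ε') x log x`
    have h2 : (c - ε') * ((x : ℝ) * Real.log x) < S x := by linarith
    have h3 : c - ε' < S x / ((x : ℝ) * Real.log x) := by rwa [lt_div_iff₀ hFx]
    linarith
  · -- upper: `S x < (c + ε') x log x`
    have h2 : S x < (c + ε') * ((x : ℝ) * Real.log x) := by linarith
    have h3 : S x / ((x : ℝ) * Real.log x) < c + ε' := by rwa [div_lt_iff₀ hFx]
    linarith

/-! ### The reduction theorem -/

/-- The canonical outer range `E*(X₁) = max(X₁, max_{n ≤ X₁}|g(n)|)`. [this work] -/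
def trapOuter (g : ℤ[X]) (X₁ : ℕ) : ℕ := max X₁ (polyEvalSup g X₁)

/-- **TRAPEZOID CANCELLATION** for `g` (smoothing parameter `Δ`): for every fixed `δ ∈ (0,1)`, uniformly in the
window `δX₀ ≤ D ≤ X₀`, the trapezoid form in UNSHIFTED Hooley sums is `o(D·X₀ log X₀)`:
`∑_{X₁<e≤E*(X₁)} e⁻¹ ∑_{0<h<e} K_e(h)·S_g(h; e) = o(D·X₀ log X₀)` (`X₁ = X₀ + D`). [this work] -/
def TrapezoidCancellation (g : ℤ[X]) (Δ : ℝ) : Prop :=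
  ∀ δ : ℝ, 0 < δ → δ < 1 → ∀ ε : ℝ, 0 < ε → ∃ x₀ : ℕ, ∀ X₀ D : ℕ, x₀ ≤ X₀ → δ * X₀ ≤ D → D ≤ X₀ →
    ‖∑ e ∈ Ioc (X₀ + D) (trapOuter g (X₀ + D)),
        (1 / (e : ℂ)) * ∑ h ∈ Ico 1 e, trapKernel g Δ X₀ D e h * hooleySum g e h‖
      ≤ ε * D * ((X₀ : ℝ) * Real.log X₀)

/-- **THE TRAPEZOID REDUCTION.**  For `g` irreducible of degree `d ≥ 3` and `Δ > 0`:
`TrapezoidCancellation g Δ → ErdosDivisorSumAsymptotic g` — Erdős's asymptotics `S_g(x) ~ d·A_g·x log x` follow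
from the cancellation of the trapezoid form in UNSHIFTED Hooley sums `S_g(h; e)`, `X₁ < e ≤ E*`, `0 < h < e`.
[this work] -/
theorem erdosDivisorSumAsymptotic_of_trapezoidCancellation {g : ℤ[X]} (hirr : Irreducible g)
    (hdeg : 3 ≤ g.natDegree) {Δ : ℝ} (hΔ : 0 < Δ) (H : TrapezoidCancellation g Δ) :
    ErdosDivisorSumAsymptotic g := by
  have hA := rootLevelConst_pos hirr (by omega)
  obtain ⟨C₀, hC₀⟩ := exists_abs_polyDivisorSum_sub_two_mul_smooth_le hirr hdeg hΔ
  obtain ⟨Cρ, hCρ0, hCρ⟩ := exists_sum_rootCount_le hirr (by omega)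
  refine tendsto_div_mul_log_of_monotone (polyDivisorSum_cast_mono g) (by positivity) ?_
  intro δ hδ hδ1 ε hε
  obtain ⟨x₁, hx₁⟩ := H δ hδ hδ1 (ε / 4) (by positivity)
  set L : ℝ := (4 * |C₀| + 8 * Cρ) / ε with hL
  refine ⟨max (max x₁ 2) ⌈Real.exp L⌉₊, fun X₀ D hX₀ hδD hDX => ?_⟩
  have hx₁X : x₁ ≤ X₀ := le_trans (le_max_left _ _) ((le_max_left _ _).trans hX₀)
  have h2X : 2 ≤ X₀ := le_trans (le_max_right _ _) ((le_max_left _ _).trans hX₀)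
  have hLX : ⌈Real.exp L⌉₊ ≤ X₀ := (le_max_right _ _).trans hX₀
  have hX0 : (0 : ℝ) < X₀ := by exact_mod_cast (show 0 < X₀ by omega)
  have hlogX : L ≤ Real.log X₀ := by
    rw [Real.le_log_iff_exp_le hX0]
    exact (Nat.le_ceil _).trans (by exact_mod_cast hLX)
  have hD0 : 0 < D := by
    have h : (0 : ℝ) < D := lt_of_lt_of_le (by positivity) hδD
    exact_mod_cast h
  -- the admissible outer range
  have hg0 : ∀ n ∈ Icc 1 (X₀ + D), g.eval (n : ℤ) ≠ 0 :=
    fun n _ => eval_natCast_ne_zero_of_irreducible hirr (by omega) n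
  have hE : ∀ n ∈ Icc 1 (X₀ + D), (g.eval (n : ℤ)).natAbs ≤ trapOuter g (X₀ + D) :=
    fun n hn => (natAbs_eval_le_polyEvalSup g hn).trans (le_max_right _ _)
  have hXE : X₀ + D ≤ trapOuter g (X₀ + D) := le_max_left _ _
  have hT := abs_sum_Ioc_smooth_sub_heur_le g Δ hg0 hE hXE
  have hZ := hx₁ X₀ D hx₁X hδD hDX
  have hρ : ∑ e ∈ Icc 1 (X₀ + D), (polyRootCountMod ![g] e : ℝ) ≤ Cρ * ((X₀ + D : ℕ) : ℝ) := by
    have h := hCρ ((X₀ + D : ℕ) : ℝ) (by exact_mod_cast (show 2 ≤ X₀ + D by omega))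
    rwa [Nat.floor_natCast] at h
  -- per-height combination
  have hcomb : ∀ x' ∈ Ioc X₀ (X₀ + D),
      |(polyDivisorSum g x' : ℝ) - 2 * (polySmoothMid g Δ x' - polySmoothHeur g Δ x' (trapOuter g (X₀ + D)))
          - (g.natDegree : ℝ) * rootLevelConst g * ((x' : ℝ) * Real.log x')| ≤ |C₀| * ((X₀ + D : ℕ) : ℝ) := by
    intro x' hx'
    have hx'' := mem_Ioc.mp hx'
    have h := hC₀ x' (trapOuter g (X₀ + D)) (by omega)
      fun n hn => hE n (Icc_subset_Icc_right hx''.2 hn)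
    refine h.trans ?_
    calc C₀ * (x' : ℝ) ≤ |C₀| * x' := mul_le_mul_of_nonneg_right (le_abs_self _) (Nat.cast_nonneg _)
      _ ≤ |C₀| * ((X₀ + D : ℕ) : ℝ) := mul_le_mul_of_nonneg_left (by exact_mod_cast hx''.2) (abs_nonneg _)
  have hsum1 : |∑ x' ∈ Ioc X₀ (X₀ + D),
      ((polyDivisorSum g x' : ℝ) - 2 * (polySmoothMid g Δ x' - polySmoothHeur g Δ x' (trapOuter g (X₀ + D)))
          - (g.natDegree : ℝ) * rootLevelConst g * ((x' : ℝ) * Real.log x'))|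
        ≤ D * (|C₀| * ((X₀ + D : ℕ) : ℝ)) := by
    refine (abs_sum_le_sum_abs _ _).trans ?_
    have h := sum_le_card_nsmul _ _ _ hcomb
    rwa [Nat.card_Ioc, Nat.add_sub_cancel_left, nsmul_eq_mul] at h
  -- assemble
  have hsplit : ∑ x' ∈ Ioc X₀ (X₀ + D),
      ((polyDivisorSum g x' : ℝ) - (g.natDegree : ℝ) * rootLevelConst g * ((x' : ℝ) * Real.log x'))
      = ∑ x' ∈ Ioc X₀ (X₀ + D),
          ((polyDivisorSum g x' : ℝ) - 2 * (polySmoothMid g Δ x' - polySmoothHeur g Δ x' (trapOuter g (X₀ + D)))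
            - (g.natDegree : ℝ) * rootLevelConst g * ((x' : ℝ) * Real.log x'))
        + 2 * ∑ x' ∈ Ioc X₀ (X₀ + D), (polySmoothMid g Δ x' - polySmoothHeur g Δ x' (trapOuter g (X₀ + D))) := by
    rw [mul_sum, ← sum_add_distrib]
    exact sum_congr rfl fun _ _ => by ring
  rw [hsplit]
  have hX1 : ((X₀ + D : ℕ) : ℝ) ≤ 2 * X₀ := by push_cast; linarith [(show (D : ℝ) ≤ X₀ by exact_mod_cast hDX)]
  have hDR : (0 : ℝ) ≤ D := Nat.cast_nonneg _
  have hkey : (4 * |C₀| + 8 * Cρ) * ((D : ℝ) * X₀) ≤ ε * ((D : ℝ) * ((X₀ : ℝ) * Real.log X₀)) := by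
    have h1 : 4 * |C₀| + 8 * Cρ ≤ ε * Real.log X₀ := by
      have h := hlogX
      rw [hL, div_le_iff₀ hε] at h
      linarith
    have h2 := mul_le_mul_of_nonneg_right h1 (by positivity : (0 : ℝ) ≤ (D : ℝ) * X₀)
    linarith
  calc |∑ x' ∈ Ioc X₀ (X₀ + D),
          ((polyDivisorSum g x' : ℝ) - 2 * (polySmoothMid g Δ x' - polySmoothHeur g Δ x' (trapOuter g (X₀ + D)))
            - (g.natDegree : ℝ) * rootLevelConst g * ((x' : ℝ) * Real.log x'))
        + 2 * ∑ x' ∈ Ioc X₀ (X₀ + D), (polySmoothMid g Δ x' - polySmoothHeur g Δ x' (trapOuter g (X₀ + D)))|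
      ≤ D * (|C₀| * ((X₀ + D : ℕ) : ℝ))
        + 2 * ((D : ℝ) * ∑ e ∈ Icc 1 (X₀ + D), (polyRootCountMod ![g] e : ℝ)
          + ‖∑ e ∈ Ioc (X₀ + D) (trapOuter g (X₀ + D)),
              (1 / (e : ℂ)) * ∑ h ∈ Ico 1 e, trapKernel g Δ X₀ D e h * hooleySum g e h‖) := by
        refine (abs_add_le _ _).trans (add_le_add hsum1 ?_)
        rw [abs_mul, abs_two]
        exact mul_le_mul_of_nonneg_left hT (by norm_num)
    _ ≤ D * (|C₀| * (2 * X₀)) + 2 * ((D : ℝ) * (Cρ * (2 * X₀)) + ε / 4 * D * ((X₀ : ℝ) * Real.log X₀)) := by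
        have h1 : (D : ℝ) * (|C₀| * ((X₀ + D : ℕ) : ℝ)) ≤ D * (|C₀| * (2 * X₀)) :=
          mul_le_mul_of_nonneg_left (mul_le_mul_of_nonneg_left hX1 (abs_nonneg _)) hDR
        have h2 : (D : ℝ) * ∑ e ∈ Icc 1 (X₀ + D), (polyRootCountMod ![g] e : ℝ) ≤ D * (Cρ * (2 * X₀)) :=
          mul_le_mul_of_nonneg_left (hρ.trans (mul_le_mul_of_nonneg_left hX1 hCρ0.le)) hDR
        linarith
    _ ≤ ε * D * ((X₀ : ℝ) * Real.log X₀) := by linarith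

end Summit.Parity.BatemanHorn.Theorems
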